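import Mathlib
import Summits.Ventures.DiscreteObjects.Mahler.TraceNu2Structure

/-!
# Trace polynomials with one complex pair and real roots anywhere off `±2` — structure (venture `DiscreteObjects`, target L)

Cell `pub-namedobj`, seat `pub-namedobj-mahler` (gen 11). Framing: lottery ticket; floor = certified
bounds/negative ranges.

Generalisation of `nu2_traceLift_certificate` (file `TraceNu2Structure`, where all certified real trace roots lie
in `(-2, 2)`) to certified real roots anywhere off `{±2}` — needed for the `ν = 3` census cores (one real trace
root `t₀` with `|t₀| > 2` plus one complex-conjugate pair; file `TraceNu3Certificate`):

* `tracePair_structure` — `Q ∈ ℤ[X]` monic of degree `d`, `T` = `d - 2` distinct real roots of `Q` off `±2`,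
  `h₊·∏(2 - t) = Q(2)`, `h₋·∏(-2 - t) = Q(-2)`; if `(h₋ - h₊)² < 32(h₊ + h₋) - 256` then `h₊, h₋ > 0` and
  `M(traceLift Q) = (∏_{t∈T} M(x² - tx + 1)) · r²` with `1 < r`, `r + r⁻¹ = (√h₊ + √h₋)/2`
  (`M(x² - tx + 1) = 1` for `|t| ≤ 2`, `(|t| + √(t² - 4))/2` otherwise);
* `quadRoot_add_inv` — `x = (|t| + √(t² - 4))/2` has `x > 1` and `x + x⁻¹ = |t|` for `|t| > 2`.
-/

namespace Summit.Ventures.DiscreteObjects.Mahler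

open Polynomial

/-- **Structure with one complex pair, real roots anywhere off `±2`.**  `Q ∈ ℤ[X]` monic of degree `d`, `T` a set
of `d - 2` distinct real roots of `Q`, none equal to `±2`; `h₊·∏(2 - t) = Q(2)`, `h₋·∏(-2 - t) = Q(-2)`; if
`(h₋ - h₊)² < 32(h₊ + h₋) - 256` then `h₊, h₋ > 0` and `M(traceLift Q) = (∏_{t∈T} M(x² - tx + 1)) · r²` with
`1 < r`, `r + r⁻¹ = (√h₊ + √h₋)/2`. -/
theorem tracePair_structure {Q : ℤ[X]} (hQ : Q.Monic) (T : Multiset ℝ) (hT : T.Nodup)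
    (hcard : Multiset.card T + 2 = Q.natDegree) (hroot : ∀ t ∈ T, aeval t Q = 0)
    (hT2 : ∀ t ∈ T, t ≠ 2 ∧ t ≠ -2) {hp hm : ℝ}
    (hhp : hp * (T.map (fun t => 2 - t)).prod = aeval (2 : ℝ) Q)
    (hhm : hm * (T.map (fun t => -2 - t)).prod = aeval (-2 : ℝ) Q)
    (hcrit : (hm - hp) ^ 2 < 32 * (hp + hm) - 256) :
    ∃ r : ℝ, 1 < r ∧ r + r⁻¹ = (Real.sqrt hp + Real.sqrt hm) / 2 ∧ 0 < hp ∧ 0 < hm ∧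
      intMahlerMeasure (traceLift Q) =
        (T.map fun t => if |t| ≤ 2 then (1 : ℝ) else (|t| + Real.sqrt (t ^ 2 - 4)) / 2).prod * r ^ 2 := by
  classical
  -- the real picture: `Q = G · H`
  set Qr : ℝ[X] := Q.map (Int.castRingHom ℝ) with hQr
  have hQrm : Qr.Monic := hQ.map _
  have hQrdeg : Qr.natDegree = Q.natDegree := natDegree_map_eq_of_injective (Int.castRingHom ℝ).injective_int _
  have hQr_eval : ∀ t : ℝ, aeval t Q = Qr.eval t := fun t => by
    rw [hQr, ← algebraMap_int_eq, eval_map_algebraMap]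
  set G : ℝ[X] := (T.map fun t => X - C t).prod with hG
  have hGm : G.Monic := monic_multiset_prod_of_monic _ _ fun t _ => monic_X_sub_C t
  have hGdeg : G.natDegree = Multiset.card T := by rw [hG, natDegree_multiset_prod_X_sub_C_eq_card]
  have hGeval : ∀ u : ℝ, G.eval u = (T.map fun t => u - t).prod := by
    intro u
    rw [hG, eval_multiset_prod, Multiset.map_map]
    exact congrArg _ (Multiset.map_congr rfl fun t _ => by simp)
  have hTle : T ≤ Qr.roots := by
    rw [Multiset.le_iff_subset hT]
    intro t ht
    rw [mem_roots hQrm.ne_zero, IsRoot.def, ← hQr_eval]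
    exact hroot t ht
  have hGdvd : G ∣ Qr :=
    calc G = (T.map fun t => X - C t).prod := hG
      _ ∣ (Qr.roots.map fun t => X - C t).prod := Multiset.prod_dvd_prod_of_le (Multiset.map_le_map hTle)
      _ ∣ Qr := prod_multiset_X_sub_C_dvd Qr
  set H : ℝ[X] := Qr /ₘ G with hH
  have hQGH : Qr = G * H := by
    have h1 := modByMonic_add_div Qr G
    rw [(modByMonic_eq_zero_iff_dvd hGm).mpr hGdvd, zero_add] at h1
    exact h1.symm
  have hHm : H.Monic := hGm.of_mul_monic_left (hQGH ▸ hQrm)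
  have hHdeg : H.natDegree = 2 := by
    have := hGm.natDegree_mul hHm
    rw [← hQGH, hQrdeg, hGdeg] at this
    omega
  set b := H.coeff 1 with hb
  set c := H.coeff 0 with hc
  have hHeq : H = X ^ 2 + C b * X + C c := by
    have h := hHm.as_sum
    rw [hHdeg, Finset.sum_range_succ, Finset.sum_range_succ, Finset.sum_range_zero] at h
    rw [h]
    simp only [pow_zero, mul_one, pow_one, zero_add]
    ring
  have hHeval : ∀ u : ℝ, H.eval u = u ^ 2 + b * u + c := by
    intro u; rw [hHeq]; simp
  -- `h₊ = H(2)`, `h₋ = H(-2)`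
  have hG2ne : (T.map fun t => 2 - t).prod ≠ 0 :=
    Multiset.prod_ne_zero fun h0 => by
      obtain ⟨t, ht, h0'⟩ := Multiset.mem_map.mp h0
      exact (hT2 t ht).1 (by linarith)
  have hGm2ne : (T.map fun t => -2 - t).prod ≠ 0 :=
    Multiset.prod_ne_zero fun h0 => by
      obtain ⟨t, ht, h0'⟩ := Multiset.mem_map.mp h0
      exact (hT2 t ht).2 (by linarith)
  have hp_eq : hp = 4 + 2 * b + c := by
    have h1 : Qr.eval 2 = G.eval 2 * H.eval 2 := by rw [hQGH, eval_mul]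
    rw [← hQr_eval, ← hhp, hGeval, hHeval, mul_comm] at h1
    have := mul_left_cancel₀ hG2ne h1
    rw [this]; ring
  have hm_eq : hm = 4 - 2 * b + c := by
    have h1 : Qr.eval (-2) = G.eval (-2) * H.eval (-2) := by rw [hQGH, eval_mul]
    rw [← hQr_eval, ← hhm, hGeval, hHeval, mul_comm] at h1
    have := mul_left_cancel₀ hGm2ne h1
    rw [this]; ring
  have hdisc : b ^ 2 < 4 * c := by rw [hp_eq, hm_eq] at hcrit; nlinarith [hcrit]
  -- the non-real root `y` of `H`
  obtain ⟨y, hyim, hyroot, hbre, hcnorm⟩ := exists_root_of_sq_lt_four_mul hdisc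
  have hp_y : hp = ‖y - 2‖ ^ 2 := by
    rw [Complex.sq_norm, Complex.normSq_apply, hp_eq, hbre, hcnorm, Complex.normSq_apply]
    simp; ring
  have hm_y : hm = ‖y + 2‖ ^ 2 := by
    rw [Complex.sq_norm, Complex.normSq_apply, hm_eq, hbre, hcnorm, Complex.normSq_apply]
    simp; ring
  have hy2 : y - 2 ≠ 0 := by
    intro h; apply hyim; have := congrArg Complex.im h; simpa using this
  have hy2' : y + 2 ≠ 0 := by
    intro h; apply hyim; have := congrArg Complex.im h; simpa using this
  have hp_pos : 0 < hp := by rw [hp_y]; exact pow_pos (norm_pos_iff.mpr hy2) 2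
  have hm_pos : 0 < hm := by rw [hm_y]; exact pow_pos (norm_pos_iff.mpr hy2') 2
  -- the complex picture: roots of `Q` over `ℂ` are `T` and `y, ȳ`
  set Qc : ℂ[X] := Q.map (Int.castRingHom ℂ) with hQc
  have hQc_eq : Qc = Qr.map (algebraMap ℝ ℂ) := by
    rw [hQr, Polynomial.map_map]
    exact congrArg (fun f => Q.map f) (RingHom.ext_int _ _)
  set Hc : ℂ[X] := H.map (algebraMap ℝ ℂ) with hHc
  have hHc_eq : Hc = X ^ 2 + C (b : ℂ) * X + C (c : ℂ) := by
    rw [hHc, hHeq]; simp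
  have hHcm : Hc.Monic := hHm.map _
  have hHc_eval : ∀ z : ℂ, Hc.eval z = aeval z H := fun z => by rw [hHc, eval_map_algebraMap]
  have hyr : Hc.IsRoot y := by
    rw [IsRoot.def, hHc_eq]; simp only [eval_add, eval_pow, eval_X, eval_mul, eval_C]; exact hyroot
  have hyr' : Hc.IsRoot (starRingEnd ℂ y) := by
    rw [IsRoot.def, hHc_eval, Polynomial.aeval_conj, ← hHc_eval, hyr.eq_zero, map_zero]
  have hne : starRingEnd ℂ y ≠ y := by rw [Ne, Complex.conj_eq_iff_im]; exact hyim
  have hHcroots : Hc.roots = {y, starRingEnd ℂ y} := by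
    symm
    apply Multiset.eq_of_le_of_card_le
    · rw [Multiset.le_iff_subset (by simp [hne.symm])]
      intro z hz
      simp only [Multiset.insert_eq_cons, Multiset.mem_cons, Multiset.mem_singleton] at hz
      rcases hz with rfl | rfl
      · exact (mem_roots hHcm.ne_zero).mpr hyr
      · exact (mem_roots hHcm.ne_zero).mpr hyr'
    · calc Multiset.card Hc.roots ≤ Hc.natDegree := card_roots' Hc
        _ = 2 := by rw [hHc, natDegree_map_eq_of_injective (algebraMap ℝ ℂ).injective, hHdeg]
        _ = Multiset.card ({y, starRingEnd ℂ y} : Multiset ℂ) := by simp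
  have hGcroots : (G.map (algebraMap ℝ ℂ)).roots = T.map (fun t : ℝ => (t : ℂ)) := by
    have : G.map (algebraMap ℝ ℂ) = ((T.map (fun t : ℝ => (t : ℂ))).map fun a => X - C a).prod := by
      rw [hG, Polynomial.map_multiset_prod, Multiset.map_map, Multiset.map_map]
      exact congrArg _ (Multiset.map_congr rfl fun t _ => by simp)
    rw [this, roots_multiset_prod_X_sub_C]
  have hQcroots : Qc.roots = T.map (fun t : ℝ => (t : ℂ)) + {y, starRingEnd ℂ y} := by
    have hne0 : G.map (algebraMap ℝ ℂ) * Hc ≠ 0 := by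
      rw [hHc, ← Polynomial.map_mul, ← hQGH, ← hQc_eq]
      exact (Polynomial.map_ne_zero_iff (Int.castRingHom ℂ).injective_int).mpr hQ.ne_zero
    rw [hQc_eq, hQGH, Polynomial.map_mul, roots_mul hne0, hGcroots, hHcroots]
  -- the Mahler measure
  obtain ⟨r, hr1, hry, hrA⟩ := mahlerMeasure_quad_complex y
  obtain ⟨r', hr1', hry', hrA'⟩ := mahlerMeasure_quad_complex (starRingEnd ℂ y)
  have hAA : ‖starRingEnd ℂ y - 2‖ + ‖starRingEnd ℂ y + 2‖ = ‖y - 2‖ + ‖y + 2‖ := by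
    have e1 : starRingEnd ℂ y - 2 = starRingEnd ℂ (y - 2) := by rw [map_sub, map_ofNat]
    have e2 : starRingEnd ℂ y + 2 = starRingEnd ℂ (y + 2) := by rw [map_add, map_ofNat]
    rw [e1, e2, Complex.norm_conj, Complex.norm_conj]
  have hrr : r' = r := by
    rw [hAA, ← hrA] at hrA'
    rcases lt_trichotomy r' r with h | h | h
    · exact absurd hrA' (ne_of_lt (add_inv_lt_add_inv hr1' h))
    · exact h
    · exact absurd hrA'.symm (ne_of_lt (add_inv_lt_add_inv hr1 h))
  have hM : intMahlerMeasure (traceLift Q) =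
      (T.map fun t => if |t| ≤ 2 then (1 : ℝ) else (|t| + Real.sqrt (t ^ 2 - 4)) / 2).prod * r ^ 2 := by
    rw [intMahlerMeasure_traceLift hQ, ← hQc, hQcroots, Multiset.map_add, Multiset.prod_add, Multiset.map_map]
    have h1 : (T.map ((fun u : ℂ => (X ^ 2 - C u * X + 1 : ℂ[X]).mahlerMeasure) ∘ fun t : ℝ => (t : ℂ))) =
        T.map fun t => if |t| ≤ 2 then (1 : ℝ) else (|t| + Real.sqrt (t ^ 2 - 4)) / 2 :=
      Multiset.map_congr rfl fun t _ => mahlerMeasure_quad_real t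
    rw [h1, Multiset.insert_eq_cons, Multiset.map_cons, Multiset.prod_cons, Multiset.map_singleton,
      Multiset.prod_singleton, hry, hry', hrr, sq]
  -- `r + r⁻¹ > 2`, so `r > 1`
  have hA : 2 < (‖y - 2‖ + ‖y + 2‖) / 2 := by
    have h1 : |y.re - 2| < ‖y - 2‖ := by
      refine lt_of_pow_lt_pow_left₀ 2 (norm_nonneg _) ?_
      rw [Complex.sq_norm, Complex.normSq_apply, sq_abs]
      simp only [Complex.sub_re, Complex.re_ofNat, Complex.sub_im, Complex.im_ofNat, sub_zero]
      nlinarith [mul_self_pos.mpr hyim]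
    have h2 : |y.re + 2| ≤ ‖y + 2‖ := by
      have := Complex.abs_re_le_norm (y + 2)
      simpa using this
    have h3 : (4 : ℝ) ≤ |y.re - 2| + |y.re + 2| := by
      have := abs_sub (y.re + 2) (y.re - 2)
      rw [show y.re + 2 - (y.re - 2) = (4 : ℝ) by ring, abs_of_pos (by norm_num : (0:ℝ) < 4)] at this
      linarith
    linarith
  have hr : 1 < r := by
    by_contra hle
    have : r = 1 := le_antisymm (not_lt.mp hle) hr1
    rw [← hrA, this] at hA
    norm_num at hA
  refine ⟨r, hr, ?_, hp_pos, hm_pos, hM⟩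
  rw [hrA, hp_y, hm_y, Real.sqrt_sq (norm_nonneg _), Real.sqrt_sq (norm_nonneg _)]

/-- `x + x⁻¹ = |t|` for `x = (|t| + √(t² - 4))/2`, `|t| > 2`; and `x > 1`. -/
theorem quadRoot_add_inv {t : ℝ} (ht : 2 < |t|) :
    1 < (|t| + Real.sqrt (t ^ 2 - 4)) / 2 ∧
      (|t| + Real.sqrt (t ^ 2 - 4)) / 2 + ((|t| + Real.sqrt (t ^ 2 - 4)) / 2)⁻¹ = |t| := by
  have hpos : 0 ≤ t ^ 2 - 4 := by nlinarith [sq_abs t]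
  set s := Real.sqrt (t ^ 2 - 4) with hs
  have hs2 : s ^ 2 = t ^ 2 - 4 := by rw [hs]; exact Real.sq_sqrt hpos
  have hs0 : 0 ≤ s := Real.sqrt_nonneg _
  have hst : s < |t| := by nlinarith [sq_abs t, abs_nonneg t]
  have hprod : (|t| + s) / 2 * ((|t| - s) / 2) = 1 := by nlinarith [sq_abs t]
  refine ⟨by linarith, ?_⟩
  rw [inv_eq_of_mul_eq_one_right hprod]; ring

end Summit.Ventures.DiscreteObjects.Mahler
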